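import Mathlib
import Summits.Ventures.HodgeRepro2.T5CyclotomicSubfieldInfinitude

/-!
# THE CM SUBFIELDS OF `ℚ(ζₘ)` ARE THE FIXED FIELDS OF THE SUBGROUPS NOT CONTAINING `−1`

Tier-5 support N2 / N3 / §G-N4.2 (seat p3, gen 81). Files 288 and 294 proved their subfields of `ℚ(ζ₂₁)` / `ℚ(ζ₁₅)`
totally complex by exhibiting a primitive cube root of unity inside — a trick. The general fact is classical: a subfield
`F ⊆ ℚ(ζₘ)` (`2 < m`) is a CM field iff the subgroup `H_F ≤ (ℤ/mℤ)ˣ` cutting it out does not contain `−1` (complex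
conjugation); otherwise `F` is totally real.

* **`isTotallyComplex_of_neg_one_notMem`**: `−1 ∉ H_F ⟹ F` totally complex — an embedding `φ` of `F` extends to an
  embedding `ψ` of `ℚ(ζₘ)` (Mathlib's `ComplexEmbedding.lift`); if `φ` were real, `ψ (c x) = conj (ψ x) = ψ x` for
  `x ∈ F`, so the conjugation `c` (`= −1`) would fix `F`;
* **`isCMField_of_neg_one_notMem`**: `−1 ∉ H_F ⟹ F` is a CM field (file 287's `isCMField_of_isTotallyComplex`);
* **`isTotallyReal_of_neg_one_mem`**: `−1 ∈ H_F ⟹ F` totally real (`F ⊆ ℚ(ζₘ)⁺`: the fixed field of the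
  conjugation is the maximal real subfield);
* **`isCMField_iff_neg_one_notMem`**: `F` is a CM field iff `−1 ∉ H_F` (with file 296's `neg_one_notMem_zmodSubgroup`
  for `⟹`; for `⟸`, `IsCMField F` is a theorem, so the iff is stated with `IsCMField` as a proposition);
* `isCMField_fixedField_of_neg_one_notMem`: for every subgroup `H ≤ Gal(ℚ(ζₘ)/ℚ)` with `galEquivZMod⁻¹ (−1) ∉ H`, the
  fixed field `ℚ(ζₘ)^H` is a CM field — the recipe for instances (files 288 / 294 without the cube-root trick).

§8(d): uses an L-value-free non-vanishing device: NO.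
-/

open NumberField NumberField.IsCMField IsCyclotomicExtension.Rat ComplexEmbedding
open Summit.Ventures.HodgeRepro2.T5CMTypeGaloisDialect Summit.Ventures.HodgeRepro2.T5CyclotomicSubfieldInertiaDeg
  Summit.Ventures.HodgeRepro2.T5CyclotomicConjugation Summit.Ventures.HodgeRepro2.T5CyclotomicSubfieldInfinitude
open scoped ComplexConjugate

namespace Summit.Ventures.HodgeRepro2.T5CyclotomicSubfieldCM

variable (m : ℕ) [NeZero m] (L : Type*) [Field L] [NumberField L] [IsCyclotomicExtension {m} ℚ L] [IsCMField L]
  (F : IntermediateField ℚ L)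

/-- **`−1 ∉ H_F ⟹ F` is totally complex**: every complex embedding `φ` of `F` extends to an embedding `ψ` of `ℚ(ζₘ)`;
if `φ` were real then `ψ (c x) = conj (ψ x) = ψ x` for all `x ∈ F`, i.e. the conjugation `c = galEquivZMod⁻¹ (−1)`
would fix `F`. -/
theorem isTotallyComplex_of_neg_one_notMem (h : (-1 : (ZMod m)ˣ) ∉ zmodSubgroup m L F) :
    IsTotallyComplex F := by
  rw [mem_zmodSubgroup_iff, ← galEquivZMod_conjGal m L, MulEquiv.symm_apply_apply,
    IntermediateField.mem_fixingSubgroup_iff] at h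
  refine ⟨fun w => ?_⟩
  rw [← InfinitePlace.not_isReal_iff_isComplex, InfinitePlace.isReal_iff, ComplexEmbedding.isReal_iff]
  intro hreal
  apply h
  intro x hx
  set φ : F →+* ℂ := w.embedding
  set ψ : L →+* ℂ := ComplexEmbedding.lift L φ with hψdef
  have hψ : ∀ y : F, ψ (algebraMap F L y) = φ y := fun y => by
    rw [hψdef, ← RingHom.comp_apply, ComplexEmbedding.lift_comp_algebraMap]
  apply ψ.injective
  have h1 : ψ (conjGal L x) = conj (ψ x) := by
    rw [conjGal_apply]
    exact complexEmbedding_complexConj L ψ x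
  have h2 : conj (φ ⟨x, hx⟩) = φ ⟨x, hx⟩ := by
    have := congrArg (fun f : F →+* ℂ => f ⟨x, hx⟩) hreal
    simpa [ComplexEmbedding.conjugate_coe_eq] using this
  rw [h1]
  have hx' : ψ x = φ ⟨x, hx⟩ := hψ ⟨x, hx⟩
  rw [hx', h2]

/-- **`−1 ∉ H_F ⟹ F` is a CM field**. -/
theorem isCMField_of_neg_one_notMem (h : (-1 : (ZMod m)ˣ) ∉ zmodSubgroup m L F) : IsCMField F :=
  haveI := isTotallyComplex_of_neg_one_notMem m L F h
  T5CyclotomicSubfieldSexticCensus.isCMField_of_isTotallyComplex m L F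

/-- **`F` is a CM field iff `−1 ∉ H_F`** (a subfield of `ℚ(ζₘ)`, `2 < m`). -/
theorem isCMField_iff_neg_one_notMem : IsCMField F ↔ (-1 : (ZMod m)ˣ) ∉ zmodSubgroup m L F :=
  ⟨fun hF => haveI := hF; neg_one_notMem_zmodSubgroup m L F, isCMField_of_neg_one_notMem m L F⟩

/-- **`−1 ∈ H_F ⟹ F` is totally real**: every element of `F` is fixed by the conjugation, hence real under every
embedding. -/
theorem isTotallyReal_of_neg_one_mem (h : (-1 : (ZMod m)ˣ) ∈ zmodSubgroup m L F) : IsTotallyReal F := by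
  rw [mem_zmodSubgroup_iff, ← galEquivZMod_conjGal m L, MulEquiv.symm_apply_apply,
    IntermediateField.mem_fixingSubgroup_iff] at h
  refine ⟨fun w => ?_⟩
  rw [InfinitePlace.isReal_iff, ComplexEmbedding.isReal_iff]
  set φ : F →+* ℂ := w.embedding
  set ψ : L →+* ℂ := ComplexEmbedding.lift L φ with hψdef
  have hψ : ∀ y : F, ψ (algebraMap F L y) = φ y := fun y => by
    rw [hψdef, ← RingHom.comp_apply, ComplexEmbedding.lift_comp_algebraMap]
  ext y
  rw [ComplexEmbedding.conjugate_coe_eq, ← hψ y, ← complexEmbedding_complexConj L ψ, ← conjGal_apply]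
  exact congrArg ψ (h y y.2)

/-- **THE RECIPE FOR INSTANCES**: for a subgroup `H ≤ Gal(ℚ(ζₘ)/ℚ)` not containing the conjugation
`galEquivZMod⁻¹ (−1)`, the fixed field `ℚ(ζₘ)^H` is a CM field. -/
theorem isCMField_fixedField_of_neg_one_notMem (H : Subgroup (L ≃ₐ[ℚ] L))
    (h : (galEquivZMod m L).symm (-1) ∉ H) : IsCMField (IntermediateField.fixedField H) := by
  apply isCMField_of_neg_one_notMem m L
  rw [mem_zmodSubgroup_iff, IntermediateField.fixingSubgroup_fixedField]
  exact h

end Summit.Ventures.HodgeRepro2.T5CyclotomicSubfieldCM
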